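import Summits.HodgeConjecture.HodgeConjecture.Theorems.Ring2AbelianAllCMAlgebraicCarriersDefs
import Literature.AlgebraicGeometry.HodgeTheory.WeilClassesLocalAnchor
import HarnessLib

/-!
# Ring 2 / AbelianAll (André column) — the node «ONE CARRIER FOR ONE WEIL CLASS ON ONE HYPERBOLIC WEIL-TYPE VARIETY» (definitions only)

research route, not a corollary; conditional on HC_CM plus one named minimal statement.

DEFINITIONS ONLY (nothing asserted, nothing proved; `HC_CM` absent). The SMALLEST carrier statement of the §AbelianAll implication table
for the hyperbolic Weil problem. The Weil ladder of the cell (`b2b-hweil`) isolated the GLOBAL half of every semiregularity argument on the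
hyperbolic (`det H = (-1)ⁿ`, split) components of the Weil-type moduli as a kernel theorem
(`WeilTypeLadder.weilClasses_algebraic_hyperbolic_of_localAnchor`: Deligne's polarised Weil family with reach `weilFamilyReach_hyperbolic` ∧
the LOCAL predicate `HodgeTheory.HasLocallyAlgebraicWeilAnchor n d` ⟹ the Weil plane of EVERY hyperbolic `(A, φ)` of dimension `2n`,
`φ² = -d`, is algebraic — one class suffices, isogeny transfer, Baire), and the local predicate asks for ONE hyperbolic anchor
`(P, ψ₀, e, a)` with ONE non-zero rational Weil class `w` such that, along every Weil family through a chart `P ≅ 𝒳_{s₀}` carrying the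
`K`-symmetrised hyperplane class `h_K = d·e^*a + ψ₀^*e^*a` and `w` as restrictions of global classes `H`, `W`, the class `q·H_sⁿ + W_s` is
algebraic near `s₀`. The ladder feeds it at the OBJECT level through Perry's twisted theorem (`hasLocallyAlgebraicWeilAnchor_of_perryTwisted_kappaAnchorObject`:
a FULLY semiregular vector bundle with `κ`-classes on the `h_K`-ray plus `w`). This file names the same cut in the road's door-GENERIC
per-variety carrier vocabulary (PART AA-a `AnchoredCarrierAt`; admissible perfect complexes, partial degree sets `I`, any door `𝒪`):

* `hyperbolicAnchorChart P h` (anchor predicate, reducible): `X` is a COPY of `P` — `e' : P.X ≅ X` — and `θ` corresponds to the fixed class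
  `h ∈ H²(P)` (`e'^*θ = h`); `hyperbolicAnchorServed P h w` (served-class map): the classes `w'` on such a copy with `e'^*w' = w` for a chart
  matching `θ` with `h`.
* `OneHyperbolicWeilCarrier 𝒪 n d` (`@[conjecture]`, door-generic): THERE IS a hyperbolic `√-d`-Weil abelian `2n`-fold `(P, ψ₀, e, a)`
  (`IsHyperbolicWeilType P ψ₀ n h_K`) with a non-zero rational Weil class `w ∈ weilClassesOf P ψ₀ n d` — VERBATIM the anchor data of
  `HasLocallyAlgebraicWeilAnchor n d` — such that `AnchoredCarrierAt 𝒪 (2n) n (hyperbolicAnchorChart P h_K) (hyperbolicAnchorServed P h_K w)`: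
  on every copy `X ≅ P`, an `𝒪`-admissible datum `(I ∋ n, κ)` ON `X` with `κ_n = a'·w' + c_n·θⁿ`, `a' ≠ 0`, `κ_q = c_q·θ^q` (`q ∈ I`, `q ≠ n`),
  `θ ↔ h_K`, `w' ↔ w`. ONE object on ONE variety of our choice (e.g. Deligne's split square `A₁ × A₁` with `A₁ = E₀ⁿ`, where the Weil plane is
  `ℂ·(R ± i√d·S)ⁿ` for rational divisor classes `R`, `S` — `weilClassesOf_splitSquare_eq_span`), serving ONE known algebraic class modulo the
  `h_K`-ray: Bloch's `a·z₀ + b·l₀ⁿ` in its smallest instance. With the door it gives `HasLocallyAlgebraicWeilAnchor n d` (companion proof file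
  `Ring2AbelianAllOneAnchorWeilCarrier`), hence — with the reach fact — the split rungs `SplitEightfolds`, `SplitWeilAbelianVarieties` and
  Markman's hyperbolic-sixfold statement BY NAME.
* `OneHyperbolicWeilTwistedCarrier n d` (`@[conjecture]`): the same for the road's twisted door `twistedReflexiveClass C AdmTw`, every `C`.

Both nodes are OPEN for `n ≥ 4` (Markman, arXiv:2502.03415 §1.2: nothing known in dimension `≥ 8` for any `K`), citation-expected from a
PREPRINT at `n = 3` (the secant sheaf on `Pic²(C) × Pic²(C)^`, Thm. 1.4.1 — the road's `SecantAnchorCarrier` files type that instance), NOT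
implied by the Hodge conjecture (a carrier is more than algebraicity) — HYPOTHESES wherever used, never cited as facts. References:
[cite: Bloch1972Semiregularity, Remark (7.5)] [cite: BuchweitzFlenner2003, §5 Thm. 5.1] [cite: Markman2025SecantWeil, Thm. 1.4.1, §1.2 and §1.5]
[cite: Deligne1982HodgeCycles, §4 proof of Thm. 4.8] [cite: vanGeemen1994HodgeAV, Lemma 5.2 and 5.4].
-/

noncomputable section

open CategoryTheory CategoryTheory.Limits AlgebraicGeometry Topology

namespace Summit.HodgeConjecture.HodgeConjecture.Ring2.AbelianAll

-- the cell's namespace repeats the summit name (`Summit.HodgeConjecture.HodgeConjecture…`), as in every `Ring2*` file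
set_option linter.dupNamespace false

open Literature.AlgebraicGeometry Literature.AlgebraicGeometry.Motives
open Literature.AlgebraicGeometry.HodgeTheory
open Literature.AlgebraicTopology.SingularHomology
open Summit.Ventures.HSemireg (ObjClass)
open Summit.HodgeConjecture.HodgeConjecture.Ring2.SemiregularRepresentatives (AnchoredCarrierAt)

/-- **Charts of ONE anchor `P` with a fixed degree-`2` class `h`** (anchor predicate for `AnchoredCarrierAt`, reducible): `X` is a copy of `P`
by an isomorphism `e' : P.X ≅ X` under which `θ` corresponds to `h` (`e'^*θ = h`). [cite: BuchweitzFlenner2003, §5 Thm. 5.1 (model fibre)]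
[folklore] -/
abbrev hyperbolicAnchorChart (P : AbelianVariety ℂ) (h : complexBetti P.X 2) : ∀ X : SchemeOver ℂ, complexBetti X 2 → Prop :=
  fun X θ ↦ ∃ e' : P.X ≅ X, complexBetti.map e'.hom 2 θ = h

/-- **The ONE served class `w` of the anchor `P`, read on its charts** (served-class map, reducible): the classes `w'` on `X` with `e'^*w' = w`
for a chart `e' : P.X ≅ X` matching `θ` with `h`. [cite: Bloch1972Semiregularity, Remark (7.5)] [folklore] -/
abbrev hyperbolicAnchorServed (P : AbelianVariety ℂ) (h : complexBetti P.X 2) {n : ℕ} (w : complexBetti P.X (2 * n)) :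
    ∀ X : SchemeOver ℂ, complexBetti X 2 → Set (complexBetti X (2 * n)) :=
  fun X θ ↦ {w' | ∃ e' : P.X ≅ X, complexBetti.map e'.hom 2 θ = h ∧ complexBetti.map e'.hom (2 * n) w' = w}

/-- **ONE CARRIER FOR ONE WEIL CLASS ON ONE HYPERBOLIC WEIL-TYPE `2n`-FOLD, for the door `𝒪` (`OneHyperbolicWeilCarrier 𝒪 n d`)**: there are a
complex abelian `2n`-fold `P` with `ψ₀ ≫ ψ₀ = -d`, a projective embedding `e` and a rational `a ≠ 0` with `(P, ψ₀)` HYPERBOLIC for the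
`K`-symmetrised hyperplane class `h_K = d·e^*a + ψ₀^*e^*a` (`IsHyperbolicWeilType`, van Geemen's `det H = (-1)ⁿ`), and a non-zero RATIONAL Weil
class `w ∈ weilClassesOf P ψ₀ n d` — verbatim the anchor data of `HodgeTheory.HasLocallyAlgebraicWeilAnchor n d` — such that on every copy
`X ≅ P` (chart matching `θ` with `h_K`) there is an `𝒪`-admissible datum `(I ∋ n, κ)` ON `X` with `κ_n = a'·w' + c_n·θⁿ`, `a' ≠ 0`, `κ_q = c_q·θ^q`
(`q ∈ I`, `q ≠ n`), `w' ↔ w`. With the door's local variational Hodge statement it gives `HasLocallyAlgebraicWeilAnchor n d` (companion proof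
file); OPEN for `n ≥ 4`, preprint-expected at `n = 3` (Markman's secant sheaf); a HYPOTHESIS wherever used.
[cite: Bloch1972Semiregularity, Remark (7.5)] [cite: Markman2025SecantWeil, Thm. 1.4.1 and §1.2] [cite: vanGeemen1994HodgeAV, Lemma 5.2 and 5.4] -/
@[conjecture] def OneHyperbolicWeilCarrier (𝒪 : ObjClass) (n d : ℕ) : Prop :=
  ∃ (P : AbelianVariety ℂ) (ψ₀ : P ⟶ P) (e : ProjectiveEmbedding P.X) (a : complexBetti (projectiveSpace e.n ℂ) 2)
    (w : complexBetti P.X (2 * n)),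
    P.dim = 2 * n ∧ ψ₀ ≫ ψ₀ = -(d • 𝟙 P) ∧ IsRationalClass a ∧ a ≠ 0 ∧
    IsHyperbolicWeilType P ψ₀ n ((d : ℂ) • complexBetti.map e.ι 2 a + complexBetti.map ψ₀.hom.hom.hom 2 (complexBetti.map e.ι 2 a)) ∧
    w ∈ weilClassesOf P ψ₀ n d ∧ IsRationalClass w ∧ w ≠ 0 ∧
    AnchoredCarrierAt 𝒪 (2 * n) n
      (hyperbolicAnchorChart P ((d : ℂ) • complexBetti.map e.ι 2 a + complexBetti.map ψ₀.hom.hom.hom 2 (complexBetti.map e.ι 2 a)))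
      (hyperbolicAnchorServed P ((d : ℂ) • complexBetti.map e.ι 2 a + complexBetti.map ψ₀.hom.hom.hom 2 (complexBetti.map e.ι 2 a)) w)

/-- **ONE TWISTED CARRIER FOR ONE WEIL CLASS ON ONE HYPERBOLIC WEIL-TYPE `2n`-FOLD (`OneHyperbolicWeilTwistedCarrier n d`)**:
`OneHyperbolicWeilCarrier` for the road's twisted door `twistedReflexiveClass C AdmTw` — `B`-twisted admissible perfect complexes,
`AdmTw := gluableSigmaAdmissible ∨ bfSingleAdmissible` — for EVERY Chern character theory `C`. OPEN for `n ≥ 4`; at `n = 3` the content of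
Markman's Thm. 1.4.1 (PREPRINT) at the secant anchor; a HYPOTHESIS wherever used. [cite: Bloch1972Semiregularity, Remark (7.5)]
[cite: Markman2025SecantWeil, Thm. 1.4.1, §1.2 and §7.3] [cite: BuchweitzFlenner2003, §5 Thm. 5.1] -/
@[conjecture] def OneHyperbolicWeilTwistedCarrier (n d : ℕ) : Prop :=
  ∀ C : ChernCharacterBetti, OneHyperbolicWeilCarrier (twistedReflexiveClass C
    (fun n X₀ I E => Summit.Ventures.HSemireg.gluableSigmaAdmissible n X₀ I E ∨
      Literature.AlgebraicGeometry.HodgeTheory.bfSingleAdmissible n X₀ I E)) n d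

end Summit.HodgeConjecture.HodgeConjecture.Ring2.AbelianAll

end
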